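import Literature.MathematicalPhysics.QuantumLattice.FreeFermionSectorEnergyDeviation
import Literature.MathematicalPhysics.QuantumLattice.ApproximateEigenvectorLemmas

/-!
# Crux `WindowInfraredBound` (stmt-HubbardSuperconductivity-1089) — the free point `U = 0`, stub S3:
# vanishing downward transfers + a fixed filling force a sharp Fermi sea

Support of the R4 calibration `FreeWindowBoundAllGroundStates` (line `free-window-calibration`, skeleton
`Cruxes/WindowInfraredBound/Lines/free_window_calibration.lean`). One spin `σ`, an abstract dispersion
`e : TorusSite 2 L → ℝ`, an abstract filling `ν : ℝ`, and the Bloch occupations `n_k = c†_{kσ} c_{kσ}`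
(commuting orthogonal projections). If `Σ_k n_k ψ = ν ψ` and every transfer to a strictly lower level kills
`ψ` (`e k < e k' ⇒ c†_{kσ} c_{k'σ} ψ = 0`), then by the CAR `n_{k'} ψ = n_k n_{k'} ψ` whenever `e k < e k'`
(`fss_momentumNumber_mulVec_eq_of_transfer`), and counting occupations against `ν` gives the registered stub
`stub_freeSeaStructure`:
* levels with `#{k' : e k' ≤ e k} ≤ ν` are sharply FILLED, `n_k ψ = ψ` (`φ = ψ − n_k ψ` has `Σ n_{k'} φ = ν φ`
  but at most `#{e ≤ e_k} − 1 ≤ ν − 1` nonzero occupations, so `ν‖φ‖² ≤ (ν − 1)‖φ‖²`);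
* levels with `ν ≤ #{k' : e k' < e k}` are sharply EMPTY, `n_k ψ = 0` (`φ = n_k ψ` has `Σ n_{k'} φ = ν φ` but
  unit occupation on the `#{e < e_k} + 1` modes `{e < e_k} ∪ {k}`, so `(#{e < e_k} + 1)‖φ‖² ≤ ν‖φ‖²`).

Sources: E. H. Lieb, M. Loss, *Analysis* (2001) Thm 1.14 (bathtub principle, equality case); J. Bardeen,
L. N. Cooper, J. R. Schrieffer, Phys. Rev. 108 (1957) 1175 §II (Bloch-mode bookkeeping of the Fermi sea).
Folklore finite-dimensional statements over the tree's definitions; no definition and no named fact is introduced.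
-/

noncomputable section

set_option linter.dupNamespace false

namespace Summit.HubbardSuperconductivity.HubbardSuperconductivity.Theorems.WindowInfraredBound

open Matrix Finset
open Literature.Probability.LatticeModels Literature.MathematicalPhysics.QuantumLattice
open scoped ComplexOrder ComplexConjugate

section SeaAlgebra

variable {L : ℕ} [NeZero L]

/-- `c†_{k'σ} c_{kσ} · c†_{kσ} c_{k'σ} = n_{k'σ} − n_{kσ} n_{k'σ} = (1 − n_{kσ}) n_{k'σ}` for `k ≠ k'`
(`c_k c†_k = 1 − n_k`, and `n_k` commutes with the mode `k'`). Bratteli–Robinson II §5.2.1. [folklore] -/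
theorem fss_transfer_adjoint_mul_transfer {k k' : TorusSite 2 L} (hkk' : k ≠ k') (σ : Fin 2) :
    momentumCreation k' σ * momentumAnnihilation k σ * (momentumCreation k σ * momentumAnnihilation k' σ) =
      momentumNumber k' σ - momentumNumber k σ * momentumNumber k' σ := by
  have hne : ¬ (k = k' ∧ σ = σ) := fun h => hkk' h.1
  calc momentumCreation k' σ * momentumAnnihilation k σ * (momentumCreation k σ * momentumAnnihilation k' σ)
      = momentumCreation k' σ * (momentumAnnihilation k σ * momentumCreation k σ) *
          momentumAnnihilation k' σ := by
        simp only [Matrix.mul_assoc]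
    _ = momentumCreation k' σ * momentumAnnihilation k' σ -
          momentumCreation k' σ * momentumNumber k σ * momentumAnnihilation k' σ := by
        rw [momentumAnnihilation_mul_momentumCreation, if_pos ⟨rfl, rfl⟩, ← momentumNumber, Matrix.mul_sub,
          Matrix.mul_one, Matrix.sub_mul]
    _ = momentumNumber k' σ - momentumNumber k σ * momentumNumber k' σ := by
        rw [← momentumNumber_mul_momentumCreation_of_ne hne, Matrix.mul_assoc, ← momentumNumber]

/-- **Slaving of the upper occupation.** If the downward transfer `c†_{kσ} c_{k'σ}` (`k ≠ k'`) annihilates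
`ψ`, then `n_{k'σ} ψ = n_{kσ} n_{k'σ} ψ` (apply `c†_{k'σ} c_{kσ}` and use
`fss_transfer_adjoint_mul_transfer`). Bardeen–Cooper–Schrieffer (1957) §II. [folklore] -/
theorem fss_momentumNumber_mulVec_eq_of_transfer {k k' : TorusSite 2 L} (hkk' : k ≠ k') (σ : Fin 2)
    {ψ : Fock (Orb (FermionTorus 2 L))} (h : (momentumCreation k σ * momentumAnnihilation k' σ) *ᵥ ψ = 0) :
    momentumNumber k' σ *ᵥ ψ = momentumNumber k σ *ᵥ (momentumNumber k' σ *ᵥ ψ) := by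
  have h1 : (momentumCreation k' σ * momentumAnnihilation k σ) *ᵥ
      ((momentumCreation k σ * momentumAnnihilation k' σ) *ᵥ ψ) = 0 := by
    rw [h, Matrix.mulVec_zero]
  rw [Matrix.mulVec_mulVec, fss_transfer_adjoint_mul_transfer hkk', Matrix.sub_mulVec, sub_eq_zero,
    ← Matrix.mulVec_mulVec] at h1
  exact h1

/-- `n_{kσ}` commutes with the spin-`σ` Bloch number `Σ_{k'} n_{k'σ}`. [folklore] -/
theorem fss_momentumNumber_commute_sum (k : TorusSite 2 L) (σ : Fin 2) :
    Commute (momentumNumber k σ) (∑ k' : TorusSite 2 L, momentumNumber k' σ) :=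
  Commute.sum_right _ _ _ fun k' _ => momentumNumber_commute k k' σ σ

/-- `Re ⟨φ, (Σ_{k'} n_{k'σ}) φ⟩ = Σ_{k'} Re ⟨φ, n_{k'σ} φ⟩`. [folklore] -/
theorem fss_re_expect_sum_momentumNumber (σ : Fin 2) (φ : Fock (Orb (FermionTorus 2 L))) :
    (star φ ⬝ᵥ ((∑ k' : TorusSite 2 L, momentumNumber k' σ) *ᵥ φ)).re =
      ∑ k' : TorusSite 2 L, (star φ ⬝ᵥ (momentumNumber k' σ *ᵥ φ)).re := by
  rw [Matrix.sum_mulVec, dotProduct_sum, Complex.re_sum]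

end SeaAlgebra

section Norms

variable {n : Type*} [Fintype n]

/-- `Re ⟨φ, ν φ⟩ = ν Re ⟨φ, φ⟩` for real `ν`. [folklore] -/
theorem fss_re_star_dotProduct_smul_self (ν : ℝ) (φ : n → ℂ) :
    (star φ ⬝ᵥ ((ν : ℂ) • φ)).re = ν * (star φ ⬝ᵥ φ).re := by
  rw [dotProduct_smul, smul_eq_mul, Complex.re_ofReal_mul]

/-- `0 ≤ Re ⟨φ, φ⟩`. [folklore] -/
theorem fss_re_star_dotProduct_self_nonneg (φ : n → ℂ) : 0 ≤ (star φ ⬝ᵥ φ).re := by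
  rw [← eucNorm_sq]; exact sq_nonneg _

/-- `Re ⟨φ, φ⟩ ≤ 0` forces `φ = 0`. [folklore] -/
theorem fss_eq_zero_of_re_star_dotProduct_self_nonpos {φ : n → ℂ} (h : (star φ ⬝ᵥ φ).re ≤ 0) :
    φ = 0 := by
  rw [← eucNorm_sq] at h
  have h0 : eucNorm φ ^ 2 = 0 := le_antisymm h (sq_nonneg _)
  have h2 : star φ ⬝ᵥ φ = 0 := by
    rw [star_dotProduct_self_eq_eucNorm_sq, h0, Complex.ofReal_zero]
  exact dotProduct_star_self_eq_zero.1 h2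

end Norms

section Sea

variable {L : ℕ} [NeZero L] {σ : Fin 2} {e : TorusSite 2 L → ℝ} {ν : ℝ} {ψ : Fock (Orb (FermionTorus 2 L))}

/-- **Filled levels.** With `Σ_k n_{kσ} ψ = ν ψ` and vanishing downward transfers, a level `k` with
`#{k' : e k' ≤ e k} ≤ ν` is sharply occupied: `n_{kσ} ψ = ψ`. The defect `φ = ψ − n_k ψ` satisfies
`Σ n_{k'} φ = ν φ`, `n_k φ = 0` and `n_{k'} φ = 0` above `k`, so `ν ‖φ‖² ≤ (#{e ≤ e_k} − 1) ‖φ‖² ≤ (ν − 1)‖φ‖²`.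
Lieb–Loss (2001) Thm 1.14. [folklore] -/
theorem fss_filled (hN : (∑ k : TorusSite 2 L, momentumNumber k σ) *ᵥ ψ = (ν : ℂ) • ψ)
    (hT : ∀ k k' : TorusSite 2 L, e k < e k' → (momentumCreation k σ * momentumAnnihilation k' σ) *ᵥ ψ = 0)
    (k : TorusSite 2 L)
    (hk : (((Finset.univ.filter fun k' : TorusSite 2 L => e k' ≤ e k).card : ℕ) : ℝ) ≤ ν) :
    momentumNumber k σ *ᵥ ψ = ψ := by
  set φ := ψ - momentumNumber k σ *ᵥ ψ with hφ
  -- occupations of `φ`: zero at `k` and at every strictly higher level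
  have hk0 : momentumNumber k σ *ᵥ φ = 0 := by
    rw [hφ, Matrix.mulVec_sub, Matrix.mulVec_mulVec, momentumNumber_mul_self, sub_self]
  have hup : ∀ k', e k < e k' → momentumNumber k' σ *ᵥ φ = 0 := by
    intro k' hlt
    have hkk' : k ≠ k' := fun h => hlt.ne (congrArg e h)
    have h := fss_momentumNumber_mulVec_eq_of_transfer hkk' σ (hT k k' hlt)
    rw [hφ, Matrix.mulVec_sub, sub_eq_zero, h]
    simp only [Matrix.mulVec_mulVec, (momentumNumber_commute k' k σ σ).eq]
  -- `Σ n_{k'} φ = ν φ`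
  have hNφ : (∑ k' : TorusSite 2 L, momentumNumber k' σ) *ᵥ φ = (ν : ℂ) • φ := by
    rw [hφ, Matrix.mulVec_sub, Matrix.mulVec_mulVec, ← (fss_momentumNumber_commute_sum k σ).eq,
      ← Matrix.mulVec_mulVec, hN, Matrix.mulVec_smul, smul_sub]
  -- `B := {e ≤ e_k} \ {k}` carries all the occupations of `φ`
  set B := (Finset.univ.filter fun k' : TorusSite 2 L => e k' ≤ e k).erase k with hB
  have hkmem : k ∈ Finset.univ.filter fun k' : TorusSite 2 L => e k' ≤ e k := by simp
  have hBcard : ((B.card : ℕ) : ℝ) ≤ ν - 1 := by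
    rw [hB, Finset.card_erase_of_mem hkmem, Nat.cast_sub (Finset.card_pos.2 ⟨k, hkmem⟩), Nat.cast_one]
    linarith
  have hsum : ν * (star φ ⬝ᵥ φ).re = ∑ k' ∈ B, (star φ ⬝ᵥ (momentumNumber k' σ *ᵥ φ)).re := by
    rw [← fss_re_star_dotProduct_smul_self, ← hNφ, fss_re_expect_sum_momentumNumber]
    symm
    refine Finset.sum_subset (Finset.subset_univ B) fun k' _ hk' => ?_
    have hcase : k' = k ∨ e k < e k' := by
      by_contra hc
      rw [not_or, not_lt] at hc
      exact hk' (by rw [hB, Finset.mem_erase]; exact ⟨hc.1, by simpa using hc.2⟩)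
    rcases hcase with rfl | hlt
    · rw [hk0, dotProduct_zero, Complex.zero_re]
    · rw [hup k' hlt, dotProduct_zero, Complex.zero_re]
  have hle : ∑ k' ∈ B, (star φ ⬝ᵥ (momentumNumber k' σ *ᵥ φ)).re ≤ B.card * (star φ ⬝ᵥ φ).re := by
    calc ∑ k' ∈ B, (star φ ⬝ᵥ (momentumNumber k' σ *ᵥ φ)).re ≤ ∑ _k' ∈ B, (star φ ⬝ᵥ φ).re :=
          Finset.sum_le_sum fun k' _ => (re_expect_momentumNumber_mem_Icc k' σ φ).2
      _ = B.card * (star φ ⬝ᵥ φ).re := by rw [Finset.sum_const, nsmul_eq_mul]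
  have hnn := fss_re_star_dotProduct_self_nonneg φ
  have hprod := mul_le_mul_of_nonneg_right hBcard hnn
  have hφ0 : φ = 0 := fss_eq_zero_of_re_star_dotProduct_self_nonpos (by linarith)
  rw [hφ] at hφ0
  exact (sub_eq_zero.1 hφ0).symm

/-- **Empty levels.** With `Σ_k n_{kσ} ψ = ν ψ` and vanishing downward transfers, a level `k` with
`ν ≤ #{k' : e k' < e k}` is sharply empty: `n_{kσ} ψ = 0`. The vector `φ = n_k ψ` satisfies `Σ n_{k'} φ = ν φ`
and `n_{k'} φ = φ` on `{e < e_k} ∪ {k}`, so `(#{e < e_k} + 1) ‖φ‖² ≤ ν ‖φ‖² ≤ #{e < e_k} ‖φ‖²`.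
Lieb–Loss (2001) Thm 1.14. [folklore] -/
theorem fss_empty (hN : (∑ k : TorusSite 2 L, momentumNumber k σ) *ᵥ ψ = (ν : ℂ) • ψ)
    (hT : ∀ k k' : TorusSite 2 L, e k < e k' → (momentumCreation k σ * momentumAnnihilation k' σ) *ᵥ ψ = 0)
    (k : TorusSite 2 L)
    (hk : ν ≤ (((Finset.univ.filter fun k' : TorusSite 2 L => e k' < e k).card : ℕ) : ℝ)) :
    momentumNumber k σ *ᵥ ψ = 0 := by
  set φ := momentumNumber k σ *ᵥ ψ with hφ
  -- occupations of `φ`: one at `k` and at every strictly lower level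
  have hk1 : momentumNumber k σ *ᵥ φ = φ := by
    rw [hφ, Matrix.mulVec_mulVec, momentumNumber_mul_self]
  have hdown : ∀ k', e k' < e k → momentumNumber k' σ *ᵥ φ = φ := by
    intro k' hlt
    have hkk' : k' ≠ k := fun h => hlt.ne (congrArg e h)
    rw [hφ]
    exact (fss_momentumNumber_mulVec_eq_of_transfer hkk' σ (hT k' k hlt)).symm
  -- `Σ n_{k'} φ = ν φ`
  have hNφ : (∑ k' : TorusSite 2 L, momentumNumber k' σ) *ᵥ φ = (ν : ℂ) • φ := by
    rw [hφ, Matrix.mulVec_mulVec, ← (fss_momentumNumber_commute_sum k σ).eq, ← Matrix.mulVec_mulVec, hN,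
      Matrix.mulVec_smul]
  set D := Finset.univ.filter fun k' : TorusSite 2 L => e k' < e k with hD
  have hkD : k ∉ D := by simp [hD]
  have hsum : ν * (star φ ⬝ᵥ φ).re = ∑ k' : TorusSite 2 L, (star φ ⬝ᵥ (momentumNumber k' σ *ᵥ φ)).re := by
    rw [← fss_re_star_dotProduct_smul_self, ← hNφ, fss_re_expect_sum_momentumNumber]
  have hge : (((D.card : ℕ) : ℝ) + 1) * (star φ ⬝ᵥ φ).re ≤
      ∑ k' : TorusSite 2 L, (star φ ⬝ᵥ (momentumNumber k' σ *ᵥ φ)).re := by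
    calc (((D.card : ℕ) : ℝ) + 1) * (star φ ⬝ᵥ φ).re = ∑ _k' ∈ insert k D, (star φ ⬝ᵥ φ).re := by
          rw [Finset.sum_const, Finset.card_insert_of_notMem hkD, nsmul_eq_mul, Nat.cast_add, Nat.cast_one]
      _ = ∑ k' ∈ insert k D, (star φ ⬝ᵥ (momentumNumber k' σ *ᵥ φ)).re := by
          refine Finset.sum_congr rfl fun k' hk' => ?_
          rw [Finset.mem_insert] at hk'
          rcases hk' with rfl | hk'
          · rw [hk1]
          · rw [hdown k' (by simpa [hD] using hk')]
      _ ≤ ∑ k' : TorusSite 2 L, (star φ ⬝ᵥ (momentumNumber k' σ *ᵥ φ)).re :=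
          Finset.sum_le_sum_of_subset_of_nonneg (Finset.subset_univ _) fun k' _ _ =>
            (re_expect_momentumNumber_mem_Icc k' σ φ).1
  have hnn := fss_re_star_dotProduct_self_nonneg φ
  have hprod := mul_le_mul_of_nonneg_right hk hnn
  exact fss_eq_zero_of_re_star_dotProduct_self_nonpos (by linarith)

end Sea

section Registered

/-- **Stub S3 — the free sea structure.** For one spin `σ`, an abstract dispersion `e` and filling `ν`:
if `Σ_k n_{kσ} ψ = ν ψ` and every transfer to a strictly lower level annihilates `ψ`
(`e k < e k' ⇒ c†_{kσ} c_{k'σ} ψ = 0`), then the levels with `#{k' : e k' ≤ e k} ≤ ν` are sharply filled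
(`n_{kσ} ψ = ψ`, `fss_filled`) and the levels with `ν ≤ #{k' : e k' < e k}` are sharply empty
(`n_{kσ} ψ = 0`, `fss_empty`). Lieb–Loss, *Analysis* (2001) Thm 1.14 (bathtub, equality case);
Bardeen–Cooper–Schrieffer, Phys. Rev. 108 (1957) 1175 §II. [folklore] -/
theorem stub_freeSeaStructure : ∀ (L : ℕ) [NeZero L] (σ : Fin 2) (e : TorusSite 2 L → ℝ) (ν : ℝ)
    (ψ : Fock (Orb (FermionTorus 2 L))),
    (∑ k : TorusSite 2 L, momentumNumber k σ) *ᵥ ψ = (ν : ℂ) • ψ →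
    (∀ k k' : TorusSite 2 L, e k < e k' → (momentumCreation k σ * momentumAnnihilation k' σ) *ᵥ ψ = 0) →
    ∀ k : TorusSite 2 L,
      ((((Finset.univ.filter fun k' : TorusSite 2 L => e k' ≤ e k).card : ℕ) : ℝ) ≤ ν →
          momentumNumber k σ *ᵥ ψ = ψ) ∧
      (ν ≤ (((Finset.univ.filter fun k' : TorusSite 2 L => e k' < e k).card : ℕ) : ℝ) →
          momentumNumber k σ *ᵥ ψ = 0) := by
  intro L _ σ e ν ψ hN hT k
  exact ⟨fss_filled hN hT k, fss_empty hN hT k⟩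

end Registered

end Summit.HubbardSuperconductivity.HubbardSuperconductivity.Theorems.WindowInfraredBound
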